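import Mathlib
import HarnessLib
import Summits.HubbardSuperconductivity.HubbardSuperconductivity.Theorems.KLProgrammeKLRegimeWickBubbleRule

/-!
# Route `KLProgramme` — ENGINE child (stmt-HubbardSuperconductivity-19855 / V14), (E2-v9): ANTISYMMETRY OF KERNELS under leg permutations
# (generic finite Grassmann algebra; E2-WICK-ROADMAP §5 (ii); cell gate-hubbard-kl, seat p1 g8)

The Feynman-rule lemmas of p485455/p487434 read the two-copy products at SORTED leg colourings; the particle–hole colourings of the bubble term at the
pair labels are interleaved.  Iterated Grassmann derivatives anticommute pairwise, so for every permutation `σ` of the leg positions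
`∂_{X ∘ σ} = sign σ • ∂_X` and `kernel F m (X ∘ σ) = sign σ · kernel F m X` — the reduction of any colouring to a sorted one.

* `iterDeriv_succ_succ_apply` — peeling two derivatives; `iterDeriv_comp_swap_zero_one` / `iterDeriv_comp_swap_castSucc_succ` — an ADJACENT
  transposition of the legs negates the iterated derivative;
* **`iterDeriv_comp_perm`** — `iterDeriv (X ∘ σ) = ((sign σ : ℤ) : R) • iterDeriv X` (adjacent transpositions generate, `Equiv.Perm.mclosure_swap_castSucc_succ`);
* **`kernel_comp_perm`** — `kernel F m (X ∘ σ) = ((sign σ : ℤ) : R) * kernel F m X`.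

Proved; no definitions; nothing about the model is asserted.
-/

noncomputable section

namespace Summit.HubbardSuperconductivity.HubbardSuperconductivity.Theorems.KLRegimeWick

set_option linter.dupNamespace false -- summit = problem name (single-conjunct summit), D-0017

open Literature.MathematicalPhysics.QuantumLattice GrassmannAlgebra Finset

section Generic

variable (R : Type*) [CommRing R] [Algebra ℚ R] {Γ : Type*}

omit [Algebra ℚ R] in
/-- Peeling two derivatives: `∂_X a = ∂_{X∘succ∘succ} (∂_{X 1} (∂_{X 0} a))`. -/
theorem iterDeriv_succ_succ_apply {m : ℕ} (X : Fin (m + 2) → Γ) (a : GrassmannAlgebra R Γ) :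
    iterDeriv R X a = iterDeriv R (fun j => X j.succ.succ) (grassmannDeriv R (X 1) (grassmannDeriv R (X 0) a)) := by
  rw [iterDeriv_succ_apply R X a, iterDeriv_succ_apply R (fun j => X j.succ)]
  rfl

omit [Algebra ℚ R] in
/-- Swapping the first two legs negates the iterated derivative. -/
theorem iterDeriv_comp_swap_zero_one {m : ℕ} (X : Fin (m + 2) → Γ) :
    iterDeriv R (X ∘ Equiv.swap (0 : Fin (m + 2)) 1) = -iterDeriv R X := by
  apply LinearMap.ext
  intro a
  have h0 : (X ∘ Equiv.swap (0 : Fin (m + 2)) 1) 0 = X 1 := by simp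
  have h1 : (X ∘ Equiv.swap (0 : Fin (m + 2)) 1) 1 = X 0 := by simp
  have h2 : (fun j : Fin m => (X ∘ Equiv.swap (0 : Fin (m + 2)) 1) j.succ.succ) = fun j => X j.succ.succ := by
    funext j
    simp only [Function.comp_apply]
    rw [Equiv.swap_apply_of_ne_of_ne (Fin.succ_ne_zero _)]
    intro h
    have : (j.succ.succ : Fin (m + 2)).val = (1 : Fin (m + 2)).val := by rw [h]
    simp [Fin.val_succ] at this
  rw [LinearMap.neg_apply, iterDeriv_succ_succ_apply R (X ∘ Equiv.swap (0 : Fin (m + 2)) 1) a, iterDeriv_succ_succ_apply R X a, h0, h1,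
    h2, grassmannDeriv_grassmannDeriv_comm R (X 0) (X 1), map_neg]

omit [Algebra ℚ R] in
/-- **An adjacent transposition of the legs negates the iterated derivative**: `∂_{X ∘ swap(i, i+1)} = −∂_X`. -/
theorem iterDeriv_comp_swap_castSucc_succ :
    ∀ {m : ℕ} (X : Fin (m + 2) → Γ) (i : Fin (m + 1)), iterDeriv R (X ∘ Equiv.swap i.castSucc i.succ) = -iterDeriv R X := by
  intro m
  induction m with
  | zero =>
    intro X i
    have hi : i = 0 := Fin.eq_zero i
    subst hi
    exact iterDeriv_comp_swap_zero_one R X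
  | succ m ih =>
    intro X i
    by_cases hi : i = 0
    · subst hi
      exact iterDeriv_comp_swap_zero_one R X
    · obtain ⟨i', rfl⟩ := Fin.exists_succ_eq.2 hi
      apply LinearMap.ext
      intro a
      have h0 : (X ∘ Equiv.swap i'.succ.castSucc i'.succ.succ) 0 = X 0 := by
        simp only [Function.comp_apply]
        rw [Equiv.swap_apply_of_ne_of_ne]
        · rw [← Fin.succ_castSucc]; exact (Fin.succ_ne_zero _).symm
        · exact (Fin.succ_ne_zero _).symm
      have htail : (fun j : Fin (m + 2) => (X ∘ Equiv.swap i'.succ.castSucc i'.succ.succ) j.succ) =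
          (fun j : Fin (m + 2) => X j.succ) ∘ Equiv.swap i'.castSucc i'.succ := by
        funext j
        simp only [Function.comp_apply]
        rw [← Fin.succ_castSucc, ← Function.Injective.map_swap (Fin.succ_injective _)]
      rw [LinearMap.neg_apply, iterDeriv_succ_apply R (X ∘ Equiv.swap i'.succ.castSucc i'.succ.succ) a, iterDeriv_succ_apply R X a, h0,
        htail, ih (fun j => X j.succ) i', LinearMap.neg_apply]

omit [Algebra ℚ R] in
/-- **`iterDeriv_comp_perm`** — iterated Grassmann derivatives are antisymmetric in the leg order:
`∂_{X ∘ σ} a = sign σ • ∂_X a` for every permutation `σ` of `Fin m`. -/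
theorem iterDeriv_comp_perm : ∀ {m : ℕ} (σ : Equiv.Perm (Fin m)) (X : Fin m → Γ) (a : GrassmannAlgebra R Γ),
    iterDeriv R (X ∘ σ) a = ((Equiv.Perm.sign σ : ℤ) : R) • iterDeriv R X a
  | 0, σ, X, a => by rw [Subsingleton.elim σ 1]; simp
  | 1, σ, X, a => by rw [Subsingleton.elim σ 1]; simp
  | m + 2, σ, X, a => by
    have hmem : σ ∈ Submonoid.closure (Set.range fun i : Fin (m + 1) => Equiv.swap i.castSucc i.succ) := by
      rw [Equiv.Perm.mclosure_swap_castSucc_succ]; exact Submonoid.mem_top σ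
    revert X a
    refine Submonoid.closure_induction (fun τ hτ => ?_) (fun X a => ?_) (fun τ τ' _ _ h1 h2 X a => ?_) hmem
    · obtain ⟨i, rfl⟩ := hτ
      intro X a
      rw [iterDeriv_comp_swap_castSucc_succ, Equiv.Perm.sign_swap (Fin.castSucc_lt_succ (i := i)).ne, Units.val_neg, Units.val_one,
        Int.cast_neg, Int.cast_one, neg_smul, one_smul, LinearMap.neg_apply]
    · simp
    · rw [show X ∘ ⇑(τ * τ') = (X ∘ τ) ∘ τ' from rfl, h2 (X ∘ τ) a, h1 X a, smul_smul, Equiv.Perm.sign_mul, Units.val_mul,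
        Int.cast_mul, mul_comm]

/-- **`kernel_comp_perm`** — kernels are totally antisymmetric: `kernel F m (X ∘ σ) = sign σ · kernel F m X`. -/
theorem kernel_comp_perm {m : ℕ} (F : GrassmannAlgebra R Γ) (σ : Equiv.Perm (Fin m)) (X : Fin m → Γ) :
    kernel R F m (X ∘ σ) = ((Equiv.Perm.sign σ : ℤ) : R) * kernel R F m X := by
  rw [kernel_def, kernel_def, iterDeriv_comp_perm, map_smul, smul_eq_mul]
  ring

end Generic

end Summit.HubbardSuperconductivity.HubbardSuperconductivity.Theorems.KLRegimeWick

end
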